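import Literature.Probability.LatticeModels.RandomClusterBoundaryPushingTools
import HarnessLib

/-!
# Pushing boundary conditions across a collar: monotone inner events (proved)

Topic `Literature/Probability/LatticeModels` (trunk `StatMech`, family `crit-ising`). The monotone
half of Kesten's boundary-condition toolkit (H. Kesten, *The incipient infinite cluster in
two-dimensional percolation*, PTRF 73 (1986), Lemma (29) and the proof of Lemma (23): "boundary
conditions far away change the probability of an inner event only by a constant factor"), for the
finite-graph random-cluster measure `φ^B_{G,p,q} = rcMeasure G p q B`, `q ≥ 1`, of the graph
`⟨E⟩ = fromEdgeSet ↑E` spanned by a finite edge set `E`, WITHOUT planarity. The geometry is abstract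
(`RandomClusterBoundaryPushingTools.lean`): a CORE vertex set, a disjoint COLLAR `Ann` such that
every `E`-edge at a core vertex has both endpoints in `Core ∪ Ann`, a wired set `W` off `Core ∪ Ann`,
`EA` = the `E`-edges touching the collar. The RSW-type input is clause (ii) of the tree's annulus
estimates: under the collar measure `φ^{Annᶜ}_{⟨EA⟩}` (everything outside the collar wired) an open
RADIAL CROSSING — an `⟨E⟩`-walk from `Core` to the outside of `Core ∪ Ann` with interior in `Ann`
and open edges — has probability `≤ 1 - c`.

* `rcMeasure_real_wired_le_free_of_radialBound` — (A) for INCREASING `I` determined by the `E`-edges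
  inside the core, `c · φ^W_{⟨E⟩}(I) ≤ φ^∅_{⟨E⟩}(I)`;
* `rcMeasure_real_free_le_wired_of_radialBound` — (B') for DECREASING `D` determined inside the
  core, `c · φ^∅_{⟨E⟩}(D) ≤ φ^W_{⟨E⟩}(D)`.

Proof ("the wired measure shields itself"). (1) `φ^W(Cross ∩ F) ≤ (1 - c) φ^W(F)` for every `F`
determined inside the core (`rcMeasure_real_radialCrossing_inter_le`): decompose `F` along the
cylinders of the region of genuine collar edges and dominate each conditional law by the collar
measure wired outside the collar (`rcMeasure_real_inter_cylinder_le_mul_fromEdgeSet`). (2) Explore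
the collar FROM OUTSIDE: off `Cross` the rim is empty (`radialCrossing_of_mem_explRim`), and on each
datum event `{𝒞 = X, 𝒟 = ∅}` the unexplored configuration is FREE on the sub-domain of the edges
off `X` (`rcMeasure_real_inter_explEvent_empty_eq_mul`); compare with the free measure of `⟨E⟩` by
free-domain monotonicity (`rcMeasure_fromEdgeSet_real_le`,
`rcMeasure_real_le_fromEdgeSet_of_isLowerSet`) and sum over the disjoint datum events. Everything is
proved; no definitions.

## References

* H. Kesten, The incipient infinite cluster in two-dimensional percolation, *Probab. Theory Related
  Fields* 73 (1986) 369–394: Lemma (29), proof of Lemma (23).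
* G. Grimmett, *The Random-Cluster Model*, Springer (2006): Lemma (4.13), Lemma (4.14).
* D. Basu, A. Sapozhnikov, Kesten's incipient infinite cluster and quasi-multiplicativity of crossing
  probabilities, *Electron. Commun. Probab.* 22 (2017) no. 26, §2.
-/

noncomputable section

open MeasureTheory Finset SimpleGraph
open Literature.Probability.Percolation (BondConfig openConnIn openGraph explSet explRim explEvent)

namespace Literature.Probability.LatticeModels

variable {V : Type*}

/-! ### The collar estimates -/

section Collar

variable [Fintype V] [DecidableEq V]

/-- **Step 1: an inner event does not help the radial crossing** (Kesten 1986, proof of Lemma (23),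
with Grimmett 2006, Lemma (4.13)–(4.14)(b)). If the collar measure wired outside the collar gives the
open radial crossing probability `≤ 1 - c`, then for every event `F` determined by the `E`-edges
inside the core and every wired set `W` off the collar, `φ^W_{⟨E⟩}(Cross ∩ F) ≤ (1 - c) φ^W_{⟨E⟩}(F)`:
decompose `F` along the cylinders of the region of genuine collar edges; on each cylinder the crossing
(increasing, determined on the collar edges) is dominated by its probability under the collar measure
wired on `Annᶜ`, which contains `W` and the endpoints of the frozen open edges.
[cite: Kesten1986, Lemma (29) and proof of Lemma (23)] -/
theorem rcMeasure_real_radialCrossing_inter_le {p q : ℝ} (hp : p ∈ Set.Icc (0 : ℝ) 1)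
    (hq : 1 ≤ q) (E EA : Finset (Sym2 V)) (Core Ann W : Set V) (hCA : ∀ v ∈ Core, v ∉ Ann)
    (hW : ∀ w ∈ W, w ∉ Core ∧ w ∉ Ann)
    (hCore : ∀ e ∈ E, (∃ v ∈ Core, v ∈ e) → ∀ x ∈ e, x ∈ Core ∨ x ∈ Ann)
    (hEA : ∀ e, e ∈ EA ↔ e ∈ E ∧ ∃ v ∈ Ann, v ∈ e) {c : ℝ}
    (hcross : (rcMeasure (fromEdgeSet (EA : Set (Sym2 V))) p q Annᶜ).real
      {ω | ∃ (a b : V) (w : (fromEdgeSet (E : Set (Sym2 V))).Walk a b), a ∈ Core ∧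
        b ∉ Core ∪ Ann ∧ (∀ z ∈ w.support, z = a ∨ z = b ∨ z ∈ Ann) ∧ ∀ e ∈ w.edges, e ∈ ω} ≤
      1 - c)
    {F : Set (BondConfig V)}
    (hF : ∀ ω₁ ω₂ : BondConfig V, (∀ e ∈ E, (∀ x ∈ e, x ∈ Core) → (e ∈ ω₁ ↔ e ∈ ω₂)) →
      (ω₁ ∈ F ↔ ω₂ ∈ F)) :
    (rcMeasure (fromEdgeSet (E : Set (Sym2 V))) p q W).real
        ({ω | ∃ (a b : V) (w : (fromEdgeSet (E : Set (Sym2 V))).Walk a b), a ∈ Core ∧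
          b ∉ Core ∪ Ann ∧ (∀ z ∈ w.support, z = a ∨ z = b ∨ z ∈ Ann) ∧ ∀ e ∈ w.edges, e ∈ ω} ∩
          F) ≤
      (1 - c) * (rcMeasure (fromEdgeSet (E : Set (Sym2 V))) p q W).real F := by
  classical
  have hq0 : 0 < q := one_pos.trans_le hq
  have hEfin := mem_edgeFinset_fromEdgeSet_iff E
  -- the region: the genuine collar edges
  set U : Finset (Sym2 V) := EA.filter (fun e ↦ ¬ e.IsDiag) with hUdef
  have hUmem : ∀ e, e ∈ U ↔ e ∈ EA ∧ ¬ e.IsDiag := fun e ↦ Finset.mem_filter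
  have hGU : fromEdgeSet (U : Set (Sym2 V)) = fromEdgeSet (EA : Set (Sym2 V)) := by
    ext u v
    simp only [fromEdgeSet_adj, Finset.mem_coe, hUmem, Sym2.mk_isDiag_iff]
    tauto
  -- `F` is determined off `U`
  have hF' : ∀ ω₁ ω₂ : BondConfig V, ω₁ ∩ (↑U)ᶜ = ω₂ ∩ (↑U)ᶜ → (ω₁ ∈ F ↔ ω₂ ∈ F) := by
    intro ω₁ ω₂ h
    refine hF ω₁ ω₂ fun e _ heC ↦ ?_
    have heU : e ∈ (↑U : Set (Sym2 V))ᶜ := by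
      intro heU
      obtain ⟨heA, -⟩ := (hUmem e).1 (Finset.mem_coe.1 heU)
      obtain ⟨-, v, hvA, hve⟩ := (hEA e).1 heA
      exact hCA v (heC v hve) hvA
    constructor
    · intro h1
      have h' : e ∈ ω₁ ∩ (↑U : Set (Sym2 V))ᶜ := ⟨h1, heU⟩
      rw [h] at h'
      exact h'.1
    · intro h2
      have h' : e ∈ ω₂ ∩ (↑U : Set (Sym2 V))ᶜ := ⟨h2, heU⟩
      rw [← h] at h'
      exact h'.1
  refine rcMeasure_real_inter_le_mul_of_cylinder_le (fromEdgeSet (E : Set (Sym2 V))) hp hq0 W U hF'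
    fun ξ hξ ↦ ?_
  -- on a cylinder: conditional domination by the collar measure wired outside the collar
  have hξW : ∀ e ∈ (↑ξ : Set (Sym2 V)), ∀ x ∈ e, x ∈ Annᶜ := by
    intro e he x hx hxA
    obtain ⟨heG, heU⟩ := Finset.mem_sdiff.1 (hξ (Finset.mem_coe.1 he))
    obtain ⟨heE, hnd⟩ := (hEfin _ e).1 heG
    exact heU ((hUmem e).2 ⟨(hEA e).2 ⟨heE, x, hxA, hx⟩, hnd⟩)
  have h1 := rcMeasure_real_inter_cylinder_le_mul_fromEdgeSet (fromEdgeSet (E : Set (Sym2 V))) hp hq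
    W U (fun e he ↦ (hEfin _ e).2 ⟨((hEA e).1 ((hUmem e).1 he).1).1, ((hUmem e).1 he).2⟩) (↑ξ)
    (W := Annᶜ) (fun w hw ↦ (hW w hw).2) hξW (isUpperSet_radialCrossing E Core Ann)
  have h2 : {ω : BondConfig V | ω ∩ ↑U ∈ {ω : BondConfig V | ∃ (a b : V)
      (w : (fromEdgeSet (E : Set (Sym2 V))).Walk a b), a ∈ Core ∧ b ∉ Core ∪ Ann ∧
        (∀ z ∈ w.support, z = a ∨ z = b ∨ z ∈ Ann) ∧ ∀ e ∈ w.edges, e ∈ ω}} =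
      {ω : BondConfig V | ∃ (a b : V) (w : (fromEdgeSet (E : Set (Sym2 V))).Walk a b),
        a ∈ Core ∧ b ∉ Core ∪ Ann ∧ (∀ z ∈ w.support, z = a ∨ z = b ∨ z ∈ Ann) ∧
          ∀ e ∈ w.edges, e ∈ ω} := by
    ext ω
    refine ⟨fun h ↦ isUpperSet_radialCrossing E Core Ann Set.inter_subset_left h, fun h ↦ ?_⟩
    refine inter_mem_radialCrossing hCore (fun e heE hnd ht ↦ ?_) h
    exact Finset.mem_coe.2 ((hUmem e).2 ⟨(hEA e).2 ⟨heE, ht⟩, hnd⟩)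
  rw [h2] at h1
  refine h1.trans ?_
  rw [mul_comm]
  refine mul_le_mul_of_nonneg_right ?_ measureReal_nonneg
  rw [rcMeasure_congr_graph hGU]
  exact hcross

/-- **Step 2 (increasing events): off the radial crossing, the wired measure is dominated by the
free one** (Kesten 1986, proof of Lemma (23): "no crossing ⇒ the exploration from outside has empty
rim ⇒ the inner law is free on a sub-domain"). For increasing `I` determined by the `E`-edges inside
the core and a wired set `W` off `Core ∪ Ann`, `φ^W_{⟨E⟩}(I ∖ Cross) ≤ φ^∅_{⟨E⟩}(I)` (`p < 1`,
`q ≥ 1`): cover `Crossᶜ` by the datum events `{𝒞 = X, 𝒟 = ∅}` of the outside-in exploration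
(`radialCrossing_of_mem_explRim`), factorise on each (`rcMeasure_real_inter_explEvent_empty_eq_mul`),
bound the free measure of the sub-domain by the free measure of `⟨E⟩`
(`rcMeasure_fromEdgeSet_real_le`) and sum the disjoint datum events.
[cite: Kesten1986, Lemma (29) and proof of Lemma (23)] -/
theorem rcMeasure_real_inter_compl_radialCrossing_le_free {p q : ℝ} (hp : p ∈ Set.Icc (0 : ℝ) 1)
    (hp1 : p < 1) (hq : 1 ≤ q) (E : Finset (Sym2 V)) (Core Ann W : Set V)
    (hCA : ∀ v ∈ Core, v ∉ Ann) (hW : ∀ w ∈ W, w ∉ Core ∧ w ∉ Ann)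
    (hCore : ∀ e ∈ E, (∃ v ∈ Core, v ∈ e) → ∀ x ∈ e, x ∈ Core ∨ x ∈ Ann)
    {I : Set (BondConfig V)} (hI : IsUpperSet I)
    (hIdet : ∀ ω₁ ω₂ : BondConfig V, (∀ e ∈ E, (∀ x ∈ e, x ∈ Core) → (e ∈ ω₁ ↔ e ∈ ω₂)) →
      (ω₁ ∈ I ↔ ω₂ ∈ I)) :
    (rcMeasure (fromEdgeSet (E : Set (Sym2 V))) p q W).real
        (I ∩ {ω | ∃ (a b : V) (w : (fromEdgeSet (E : Set (Sym2 V))).Walk a b), a ∈ Core ∧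
          b ∉ Core ∪ Ann ∧ (∀ z ∈ w.support, z = a ∨ z = b ∨ z ∈ Ann) ∧ ∀ e ∈ w.edges, e ∈ ω}ᶜ) ≤
      (rcMeasure (fromEdgeSet (E : Set (Sym2 V))) p q ∅).real I := by
  classical
  have hq0 : 0 < q := one_pos.trans_le hq
  haveI := isProbabilityMeasure_rcMeasure (fromEdgeSet (E : Set (Sym2 V))) hp hq0 W
  set Rest : Set V := {v | v ∉ Core ∧ v ∉ Ann} with hRest
  have hRest' : ∀ v, v ∈ Rest ↔ v ∉ Core ∧ v ∉ Ann := fun v ↦ Iff.rfl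
  have hWR : W ⊆ Rest := fun w hw ↦ hW w hw
  -- (i) off the crossing event the rim of the outside-in exploration is empty
  have h1 : (rcMeasure (fromEdgeSet (E : Set (Sym2 V))) p q W).real
        (I ∩ {ω | ∃ (a b : V) (w : (fromEdgeSet (E : Set (Sym2 V))).Walk a b), a ∈ Core ∧
          b ∉ Core ∪ Ann ∧ (∀ z ∈ w.support, z = a ∨ z = b ∨ z ∈ Ann) ∧ ∀ e ∈ w.edges, e ∈ ω}ᶜ) ≤
      (rcMeasure (fromEdgeSet (E : Set (Sym2 V))) p q W).real
        (⋃ X ∈ (Finset.univ : Finset (Set V)), (I ∩ explEvent Rest Ann X ∅)) := by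
    refine rcMeasure_real_mono_of_forall_subset_edgeSet _ hp hq0 W fun ω hω hωI ↦ ?_
    obtain ⟨hωI, hωC⟩ := hωI
    refine Set.mem_iUnion₂.2 ⟨explSet Rest Ann ω, Finset.mem_univ _, hωI, rfl, ?_⟩
    exact Set.eq_empty_of_forall_notMem fun r hr ↦
      hωC (radialCrossing_of_mem_explRim hCA hCore hRest' hω hr)
  -- (ii) on each datum event, the inner law is free on a sub-domain
  have h3 : ∀ X : Set V,
      (rcMeasure (fromEdgeSet (E : Set (Sym2 V))) p q W).real (I ∩ explEvent Rest Ann X ∅) ≤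
        (rcMeasure (fromEdgeSet (E : Set (Sym2 V))) p q W).real (explEvent Rest Ann X ∅) *
          (rcMeasure (fromEdgeSet (E : Set (Sym2 V))) p q ∅).real I := by
    intro X
    by_cases hne : (explEvent Rest Ann X ∅).Nonempty
    · obtain ⟨ω₀, hω₀⟩ := hne
      obtain ⟨U, hU, hUE, hAgree⟩ := exists_region_off_explSet hCA hRest' hω₀.1 hIdet
      calc (rcMeasure (fromEdgeSet (E : Set (Sym2 V))) p q W).real (I ∩ explEvent Rest Ann X ∅)
          = (rcMeasure (fromEdgeSet (E : Set (Sym2 V))) p q W).real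
              ({ω | ω ∩ ↑U ∈ I} ∩ explEvent Rest Ann X ∅) :=
            measureReal_congr <| rcMeasure_ae_eq_of_forall_subset_edgeSet _ hp hq0 W fun ω hω ↦ by
              simp only [Set.mem_inter_iff, Set.mem_setOf_eq, hAgree ω hω]
        _ = (rcMeasure (fromEdgeSet (E : Set (Sym2 V))) p q W).real (explEvent Rest Ann X ∅) *
              (rcMeasure (fromEdgeSet (U : Set (Sym2 V))) p q ∅).real I :=
            rcMeasure_real_inter_explEvent_empty_eq_mul _ hp hq0 hWR X U hU I
        _ ≤ (rcMeasure (fromEdgeSet (E : Set (Sym2 V))) p q W).real (explEvent Rest Ann X ∅) *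
              (rcMeasure (fromEdgeSet (E : Set (Sym2 V))) p q ∅).real I := by
            refine mul_le_mul_of_nonneg_left ?_ measureReal_nonneg
            calc (rcMeasure (fromEdgeSet (U : Set (Sym2 V))) p q ∅).real I
                ≤ (rcMeasure (fromEdgeSet (E : Set (Sym2 V))) p q ∅).real {ω | ω ∩ ↑U ∈ I} :=
                  rcMeasure_fromEdgeSet_real_le _ hp hq ∅ U (hUE _)
                    (rcMeasure_real_cylinder_empty_pos _ hp hp1 hq0 ∅ U) hI
              _ = (rcMeasure (fromEdgeSet (E : Set (Sym2 V))) p q ∅).real I :=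
                  measureReal_congr <|
                    rcMeasure_ae_eq_of_forall_subset_edgeSet _ hp hq0 ∅ fun ω hω ↦ hAgree ω hω
    · rw [Set.not_nonempty_iff_eq_empty.1 hne, Set.inter_empty, measureReal_empty, zero_mul]
  -- (iii) the datum events are pairwise disjoint
  have h4 : ∑ X ∈ (Finset.univ : Finset (Set V)),
        (rcMeasure (fromEdgeSet (E : Set (Sym2 V))) p q W).real (explEvent Rest Ann X ∅) =
      (rcMeasure (fromEdgeSet (E : Set (Sym2 V))) p q W).real
        (⋃ X ∈ (Finset.univ : Finset (Set V)), explEvent Rest Ann X ∅) :=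
    (measureReal_biUnion_finset (fun X _ Y _ hXY ↦
      Percolation.disjoint_explEvent fun h ↦ hXY (congrArg Prod.fst h))
      fun _ _ ↦ MeasurableSet.of_discrete).symm
  have h5 : (rcMeasure (fromEdgeSet (E : Set (Sym2 V))) p q W).real
      (⋃ X ∈ (Finset.univ : Finset (Set V)), explEvent Rest Ann X ∅) ≤ 1 := measureReal_le_one
  calc (rcMeasure (fromEdgeSet (E : Set (Sym2 V))) p q W).real
        (I ∩ {ω | ∃ (a b : V) (w : (fromEdgeSet (E : Set (Sym2 V))).Walk a b), a ∈ Core ∧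
          b ∉ Core ∪ Ann ∧ (∀ z ∈ w.support, z = a ∨ z = b ∨ z ∈ Ann) ∧ ∀ e ∈ w.edges, e ∈ ω}ᶜ)
      ≤ _ := h1
    _ ≤ ∑ X ∈ (Finset.univ : Finset (Set V)),
          (rcMeasure (fromEdgeSet (E : Set (Sym2 V))) p q W).real (I ∩ explEvent Rest Ann X ∅) :=
        measureReal_biUnion_finset_le _ _
    _ ≤ ∑ X ∈ (Finset.univ : Finset (Set V)),
          (rcMeasure (fromEdgeSet (E : Set (Sym2 V))) p q W).real (explEvent Rest Ann X ∅) *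
            (rcMeasure (fromEdgeSet (E : Set (Sym2 V))) p q ∅).real I :=
        Finset.sum_le_sum fun X _ ↦ h3 X
    _ = (∑ X ∈ (Finset.univ : Finset (Set V)),
          (rcMeasure (fromEdgeSet (E : Set (Sym2 V))) p q W).real (explEvent Rest Ann X ∅)) *
            (rcMeasure (fromEdgeSet (E : Set (Sym2 V))) p q ∅).real I := (Finset.sum_mul _ _ _).symm
    _ ≤ 1 * (rcMeasure (fromEdgeSet (E : Set (Sym2 V))) p q ∅).real I :=
        mul_le_mul_of_nonneg_right (h4 ▸ h5) measureReal_nonneg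
    _ = _ := one_mul _

/-- **Step 2 (decreasing events): the wired measure charges a decreasing inner event at least as
much as "no radial crossing" times the free measure** (Kesten 1986, proof of Lemma (23)). For
decreasing `D` determined by the `E`-edges inside the core and a wired set `W` off `Core ∪ Ann`,
`φ^W_{⟨E⟩}(Crossᶜ) · φ^∅_{⟨E⟩}(D) ≤ φ^W_{⟨E⟩}(D)` (`p < 1`, `q ≥ 1`): on each datum event
`{𝒞 = X, 𝒟 = ∅}` of the outside-in exploration the inner law is the free measure of a sub-domain,
which charges `D` at least as much as the free measure of `⟨E⟩`
(`rcMeasure_real_le_fromEdgeSet_of_isLowerSet`).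
[cite: Kesten1986, Lemma (29) and proof of Lemma (23)] -/
theorem rcMeasure_real_compl_radialCrossing_mul_free_le {p q : ℝ} (hp : p ∈ Set.Icc (0 : ℝ) 1)
    (hp1 : p < 1) (hq : 1 ≤ q) (E : Finset (Sym2 V)) (Core Ann W : Set V)
    (hCA : ∀ v ∈ Core, v ∉ Ann) (hW : ∀ w ∈ W, w ∉ Core ∧ w ∉ Ann)
    (hCore : ∀ e ∈ E, (∃ v ∈ Core, v ∈ e) → ∀ x ∈ e, x ∈ Core ∨ x ∈ Ann)
    {D : Set (BondConfig V)} (hD : IsLowerSet D)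
    (hDdet : ∀ ω₁ ω₂ : BondConfig V, (∀ e ∈ E, (∀ x ∈ e, x ∈ Core) → (e ∈ ω₁ ↔ e ∈ ω₂)) →
      (ω₁ ∈ D ↔ ω₂ ∈ D)) :
    (rcMeasure (fromEdgeSet (E : Set (Sym2 V))) p q W).real
        {ω | ∃ (a b : V) (w : (fromEdgeSet (E : Set (Sym2 V))).Walk a b), a ∈ Core ∧
          b ∉ Core ∪ Ann ∧ (∀ z ∈ w.support, z = a ∨ z = b ∨ z ∈ Ann) ∧ ∀ e ∈ w.edges, e ∈ ω}ᶜ *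
      (rcMeasure (fromEdgeSet (E : Set (Sym2 V))) p q ∅).real D ≤
      (rcMeasure (fromEdgeSet (E : Set (Sym2 V))) p q W).real D := by
  classical
  have hq0 : 0 < q := one_pos.trans_le hq
  haveI := isProbabilityMeasure_rcMeasure (fromEdgeSet (E : Set (Sym2 V))) hp hq0 W
  set Rest : Set V := {v | v ∉ Core ∧ v ∉ Ann} with hRest
  have hRest' : ∀ v, v ∈ Rest ↔ v ∉ Core ∧ v ∉ Ann := fun v ↦ Iff.rfl
  have hWR : W ⊆ Rest := fun w hw ↦ hW w hw
  -- (i) off the crossing event the rim of the outside-in exploration is empty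
  have h1 : (rcMeasure (fromEdgeSet (E : Set (Sym2 V))) p q W).real
        {ω | ∃ (a b : V) (w : (fromEdgeSet (E : Set (Sym2 V))).Walk a b), a ∈ Core ∧
          b ∉ Core ∪ Ann ∧ (∀ z ∈ w.support, z = a ∨ z = b ∨ z ∈ Ann) ∧ ∀ e ∈ w.edges, e ∈ ω}ᶜ ≤
      (rcMeasure (fromEdgeSet (E : Set (Sym2 V))) p q W).real
        (⋃ X ∈ (Finset.univ : Finset (Set V)), explEvent Rest Ann X ∅) := by
    refine rcMeasure_real_mono_of_forall_subset_edgeSet _ hp hq0 W fun ω hω hωC ↦ ?_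
    refine Set.mem_iUnion₂.2 ⟨explSet Rest Ann ω, Finset.mem_univ _, rfl, ?_⟩
    exact Set.eq_empty_of_forall_notMem fun r hr ↦
      hωC (radialCrossing_of_mem_explRim hCA hCore hRest' hω hr)
  -- (ii) on each datum event, the inner law is free on a sub-domain
  have h3 : ∀ X : Set V,
      (rcMeasure (fromEdgeSet (E : Set (Sym2 V))) p q W).real (explEvent Rest Ann X ∅) *
          (rcMeasure (fromEdgeSet (E : Set (Sym2 V))) p q ∅).real D ≤
        (rcMeasure (fromEdgeSet (E : Set (Sym2 V))) p q W).real (D ∩ explEvent Rest Ann X ∅) := by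
    intro X
    by_cases hne : (explEvent Rest Ann X ∅).Nonempty
    · obtain ⟨ω₀, hω₀⟩ := hne
      obtain ⟨U, hU, hUE, hAgree⟩ := exists_region_off_explSet hCA hRest' hω₀.1 hDdet
      calc (rcMeasure (fromEdgeSet (E : Set (Sym2 V))) p q W).real (explEvent Rest Ann X ∅) *
            (rcMeasure (fromEdgeSet (E : Set (Sym2 V))) p q ∅).real D
          ≤ (rcMeasure (fromEdgeSet (E : Set (Sym2 V))) p q W).real (explEvent Rest Ann X ∅) *
              (rcMeasure (fromEdgeSet (U : Set (Sym2 V))) p q ∅).real D := by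
            refine mul_le_mul_of_nonneg_left ?_ measureReal_nonneg
            calc (rcMeasure (fromEdgeSet (E : Set (Sym2 V))) p q ∅).real D
                = (rcMeasure (fromEdgeSet (E : Set (Sym2 V))) p q ∅).real {ω | ω ∩ ↑U ∈ D} :=
                  measureReal_congr <|
                    rcMeasure_ae_eq_of_forall_subset_edgeSet _ hp hq0 ∅ fun ω hω ↦
                      (hAgree ω hω).symm
              _ ≤ (rcMeasure (fromEdgeSet (U : Set (Sym2 V))) p q ∅).real D :=
                  rcMeasure_real_le_fromEdgeSet_of_isLowerSet _ hp hq ∅ U (hUE _)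
                    (rcMeasure_real_cylinder_empty_pos _ hp hp1 hq0 ∅ U) hD
        _ = (rcMeasure (fromEdgeSet (E : Set (Sym2 V))) p q W).real
              ({ω | ω ∩ ↑U ∈ D} ∩ explEvent Rest Ann X ∅) :=
            (rcMeasure_real_inter_explEvent_empty_eq_mul _ hp hq0 hWR X U hU D).symm
        _ = (rcMeasure (fromEdgeSet (E : Set (Sym2 V))) p q W).real (D ∩ explEvent Rest Ann X ∅) :=
            measureReal_congr <| rcMeasure_ae_eq_of_forall_subset_edgeSet _ hp hq0 W fun ω hω ↦ by
              simp only [Set.mem_inter_iff, Set.mem_setOf_eq, hAgree ω hω]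
    · rw [Set.not_nonempty_iff_eq_empty.1 hne, Set.inter_empty, measureReal_empty, zero_mul]
  -- (iii) the datum events are pairwise disjoint
  have h4 : ∑ X ∈ (Finset.univ : Finset (Set V)),
        (rcMeasure (fromEdgeSet (E : Set (Sym2 V))) p q W).real (explEvent Rest Ann X ∅) =
      (rcMeasure (fromEdgeSet (E : Set (Sym2 V))) p q W).real
        (⋃ X ∈ (Finset.univ : Finset (Set V)), explEvent Rest Ann X ∅) :=
    (measureReal_biUnion_finset (fun X _ Y _ hXY ↦
      Percolation.disjoint_explEvent fun h ↦ hXY (congrArg Prod.fst h))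
      fun _ _ ↦ MeasurableSet.of_discrete).symm
  have h5 : ∑ X ∈ (Finset.univ : Finset (Set V)),
        (rcMeasure (fromEdgeSet (E : Set (Sym2 V))) p q W).real (D ∩ explEvent Rest Ann X ∅) =
      (rcMeasure (fromEdgeSet (E : Set (Sym2 V))) p q W).real
        (⋃ X ∈ (Finset.univ : Finset (Set V)), (D ∩ explEvent Rest Ann X ∅)) :=
    (measureReal_biUnion_finset (fun X _ Y _ hXY ↦
      (Percolation.disjoint_explEvent fun h ↦ hXY (congrArg Prod.fst h)).mono
        Set.inter_subset_right Set.inter_subset_right)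
      fun _ _ ↦ MeasurableSet.of_discrete).symm
  calc (rcMeasure (fromEdgeSet (E : Set (Sym2 V))) p q W).real
        {ω | ∃ (a b : V) (w : (fromEdgeSet (E : Set (Sym2 V))).Walk a b), a ∈ Core ∧
          b ∉ Core ∪ Ann ∧ (∀ z ∈ w.support, z = a ∨ z = b ∨ z ∈ Ann) ∧ ∀ e ∈ w.edges, e ∈ ω}ᶜ *
        (rcMeasure (fromEdgeSet (E : Set (Sym2 V))) p q ∅).real D
      ≤ (rcMeasure (fromEdgeSet (E : Set (Sym2 V))) p q W).real
          (⋃ X ∈ (Finset.univ : Finset (Set V)), explEvent Rest Ann X ∅) *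
          (rcMeasure (fromEdgeSet (E : Set (Sym2 V))) p q ∅).real D :=
        mul_le_mul_of_nonneg_right h1 measureReal_nonneg
    _ = ∑ X ∈ (Finset.univ : Finset (Set V)),
          (rcMeasure (fromEdgeSet (E : Set (Sym2 V))) p q W).real (explEvent Rest Ann X ∅) *
            (rcMeasure (fromEdgeSet (E : Set (Sym2 V))) p q ∅).real D := by
        rw [← h4, Finset.sum_mul]
    _ ≤ ∑ X ∈ (Finset.univ : Finset (Set V)),
          (rcMeasure (fromEdgeSet (E : Set (Sym2 V))) p q W).real (D ∩ explEvent Rest Ann X ∅) :=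
        Finset.sum_le_sum fun X _ ↦ h3 X
    _ = _ := h5
    _ ≤ (rcMeasure (fromEdgeSet (E : Set (Sym2 V))) p q W).real D :=
        measureReal_mono (Set.iUnion₂_subset fun X _ ↦ Set.inter_subset_left) (measure_ne_top _ _)

/-- **(A) Wired-versus-free for increasing inner events across a collar without open radial
crossings** (Kesten 1986, Lemma (29) and proof of Lemma (23), for the random-cluster measure,
`q ≥ 1`, `0 ≤ p < 1`): if under the collar measure wired outside the collar an open radial crossing
has probability `≤ 1 - c`, then for every increasing event `I` determined by the `E`-edges inside
the core and every wired set `W` off `Core ∪ Ann`, `c · φ^W_{⟨E⟩}(I) ≤ φ^∅_{⟨E⟩}(I)`.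
[cite: Kesten1986, Lemma (29) and proof of Lemma (23)] -/
theorem rcMeasure_real_wired_le_free_of_radialBound : ∀ {V : Type*} [Fintype V] [DecidableEq V] {p q : ℝ}, p ∈ Set.Ico (0 : ℝ) 1 → 1 ≤ q → ∀ (E EA : Finset (Sym2 V)) (Core Ann W : Set V), (∀ v ∈ Core, v ∉ Ann) → (∀ w ∈ W, w ∉ Core ∧ w ∉ Ann) → (∀ e ∈ E, (∃ v ∈ Core, v ∈ e) → ∀ x ∈ e, x ∈ Core ∨ x ∈ Ann) → (∀ e, e ∈ EA ↔ e ∈ E ∧ ∃ v ∈ Ann, v ∈ e) → ∀ {c : ℝ}, 0 < c → (Literature.Probability.LatticeModels.rcMeasure (SimpleGraph.fromEdgeSet (EA : Set (Sym2 V))) p q Annᶜ).real {ω | ∃ (a b : V) (w : (SimpleGraph.fromEdgeSet (E : Set (Sym2 V))).Walk a b), a ∈ Core ∧ b ∉ Core ∪ Ann ∧ (∀ z ∈ w.support, z = a ∨ z = b ∨ z ∈ Ann) ∧ ∀ e ∈ w.edges, e ∈ ω} ≤ 1 - c → ∀ {I : Set (Literature.Probability.Percolation.BondConfig V)}, IsUpperSet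 I → (∀ ω₁ ω₂ : Literature.Probability.Percolation.BondConfig V, (∀ e ∈ E, (∀ x ∈ e, x ∈ Core) → (e ∈ ω₁ ↔ e ∈ ω₂)) → (ω₁ ∈ I ↔ ω₂ ∈ I)) → c * (Literature.Probability.LatticeModels.rcMeasure (SimpleGraph.fromEdgeSet (E : Set (Sym2 V))) p q W).real I ≤ (Literature.Probability.LatticeModels.rcMeasure (SimpleGraph.fromEdgeSet (E : Set (Sym2 V))) p q ∅).real I := by
  intro V _ _ p q hp hq E EA Core Ann W hCA hW hCore hEA c hc hcross I hI hIdet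
  have hp' : p ∈ Set.Icc (0 : ℝ) 1 := ⟨hp.1, hp.2.le⟩
  have hq0 : 0 < q := one_pos.trans_le hq
  haveI := isProbabilityMeasure_rcMeasure (fromEdgeSet (E : Set (Sym2 V))) hp' hq0 W
  have hS1 :=
    rcMeasure_real_radialCrossing_inter_le hp' hq E EA Core Ann W hCA hW hCore hEA hcross hIdet
  have hS2 := rcMeasure_real_inter_compl_radialCrossing_le_free hp' hp.2 hq E Core Ann W hCA hW hCore
    hI hIdet
  have hsplit := measureReal_inter_add_sdiff (μ := rcMeasure (fromEdgeSet (E : Set (Sym2 V))) p q W)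
    (s := I) (t := {ω | ∃ (a b : V) (w : (fromEdgeSet (E : Set (Sym2 V))).Walk a b), a ∈ Core ∧
      b ∉ Core ∪ Ann ∧ (∀ z ∈ w.support, z = a ∨ z = b ∨ z ∈ Ann) ∧ ∀ e ∈ w.edges, e ∈ ω})
    MeasurableSet.of_discrete
  rw [Set.sdiff_eq] at hsplit
  rw [Set.inter_comm] at hS1
  linarith

/-- **(B') Free-versus-wired for decreasing inner events across a collar without open radial
crossings** (Kesten 1986, Lemma (29) and proof of Lemma (23), for the random-cluster measure,
`q ≥ 1`, `0 ≤ p < 1`): under the hypotheses of (A), for every decreasing event `D` determined by the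
`E`-edges inside the core, `c · φ^∅_{⟨E⟩}(D) ≤ φ^W_{⟨E⟩}(D)`.
[cite: Kesten1986, Lemma (29) and proof of Lemma (23)] -/
theorem rcMeasure_real_free_le_wired_of_radialBound : ∀ {V : Type*} [Fintype V] [DecidableEq V] {p q : ℝ}, p ∈ Set.Ico (0 : ℝ) 1 → 1 ≤ q → ∀ (E EA : Finset (Sym2 V)) (Core Ann W : Set V), (∀ v ∈ Core, v ∉ Ann) → (∀ w ∈ W, w ∉ Core ∧ w ∉ Ann) → (∀ e ∈ E, (∃ v ∈ Core, v ∈ e) → ∀ x ∈ e, x ∈ Core ∨ x ∈ Ann) → (∀ e, e ∈ EA ↔ e ∈ E ∧ ∃ v ∈ Ann, v ∈ e) → ∀ {c : ℝ}, 0 < c → (Literature.Probability.LatticeModels.rcMeasure (SimpleGraph.fromEdgeSet (EA : Set (Sym2 V))) p q Annᶜ).real {ω | ∃ (a b : V) (w : (SimpleGraph.fromEdgeSet (E : Set (Sym2 V))).Walk a b), a ∈ Core ∧ b ∉ Core ∪ Ann ∧ (∀ z ∈ w.support, z = a ∨ z = b ∨ z ∈ Ann) ∧ ∀ e ∈ w.edges,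 e ∈ ω} ≤ 1 - c → ∀ {D : Set (Literature.Probability.Percolation.BondConfig V)}, IsLowerSet D → (∀ ω₁ ω₂ : Literature.Probability.Percolation.BondConfig V, (∀ e ∈ E, (∀ x ∈ e, x ∈ Core) → (e ∈ ω₁ ↔ e ∈ ω₂)) → (ω₁ ∈ D ↔ ω₂ ∈ D)) → c * (Literature.Probability.LatticeModels.rcMeasure (SimpleGraph.fromEdgeSet (E : Set (Sym2 V))) p q ∅).real D ≤ (Literature.Probability.LatticeModels.rcMeasure (SimpleGraph.fromEdgeSet (E : Set (Sym2 V))) p q W).real D := by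
  intro V _ _ p q hp hq E EA Core Ann W hCA hW hCore hEA c hc hcross D hD hDdet
  have hp' : p ∈ Set.Icc (0 : ℝ) 1 := ⟨hp.1, hp.2.le⟩
  have hq0 : 0 < q := one_pos.trans_le hq
  haveI := isProbabilityMeasure_rcMeasure (fromEdgeSet (E : Set (Sym2 V))) hp' hq0 W
  -- the crossing probability under the wired measure of `⟨E⟩` is at most `1 - c`
  have hS1 := rcMeasure_real_radialCrossing_inter_le hp' hq E EA Core Ann W hCA hW hCore hEA hcross
    (F := Set.univ) (fun _ _ _ ↦ Iff.rfl)
  rw [Set.inter_univ, probReal_univ, mul_one] at hS1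
  have hcompl := probReal_compl_eq_one_sub (μ := rcMeasure (fromEdgeSet (E : Set (Sym2 V))) p q W)
    (s := {ω | ∃ (a b : V) (w : (fromEdgeSet (E : Set (Sym2 V))).Walk a b), a ∈ Core ∧
      b ∉ Core ∪ Ann ∧ (∀ z ∈ w.support, z = a ∨ z = b ∨ z ∈ Ann) ∧ ∀ e ∈ w.edges, e ∈ ω})
    MeasurableSet.of_discrete
  have hS2 := rcMeasure_real_compl_radialCrossing_mul_free_le hp' hp.2 hq E Core Ann W hCA hW hCore
    hD hDdet
  have hc' : c ≤ (rcMeasure (fromEdgeSet (E : Set (Sym2 V))) p q W).real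
      {ω | ∃ (a b : V) (w : (fromEdgeSet (E : Set (Sym2 V))).Walk a b), a ∈ Core ∧
        b ∉ Core ∪ Ann ∧ (∀ z ∈ w.support, z = a ∨ z = b ∨ z ∈ Ann) ∧ ∀ e ∈ w.edges, e ∈ ω}ᶜ := by
    rw [hcompl]
    linarith
  exact (mul_le_mul_of_nonneg_right hc' measureReal_nonneg).trans hS2

end Collar

end Literature.Probability.LatticeModels

end
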